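import Summits.HubbardSuperconductivity.HubbardSuperconductivity.Theorems.AnisotropyChordTransferFibre3FinXBCover

/-!
# Route `AnisotropyChord` / H0 rotor rung: FIN exact-block row-`N₁` certificate at `L = 12` — cell facts, part `a`

Kernel facts `xbCellAny 12 (49/50) la lb c = true` (`decide +kernel`, zero data) for 9 λ-cells of the per-`L` cover
(`…FinXBCover.xbCheck`; cell design: p3 g5 scratch `xb_design.py`, float mirror `xb_mirror.py`); assembled in `…FinXBTwelve`.
Prover seat `hubbard-h0-rotor-p3` g5; helper for piece A = stmt-HubbardSuperconductivity-23918 of rung 19089 (`--supports`, helper class).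
WHAT THIS IS NOT: nothing here proves superconductivity in the Hubbard model (rotor TARGET as worded stays FALSE, g15 verdict); kernel facts for the FIN certificate of ONE hypothesis (row `N₁`) of ONE conditional reduction.  Tree imports only; no sorry, no new axioms.
-/

namespace Summit.HubbardSuperconductivity.HubbardSuperconductivity.Theorems.AnisotropyChord.Transfer.Fibre3

namespace FinXB

set_option maxHeartbeats 4000000 in
/-- kernel fact: cell 13 at `L = 12` (certified, c = (1/2 : ℚ)). [folklore] -/
theorem xb12_13 : xbCellAny 12 (49/50 : ℚ) 569519897878305 575215096857089 (1/2 : ℚ) = true := by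
  decide +kernel

set_option maxHeartbeats 4000000 in
/-- kernel fact: cell 14 at `L = 12` (certified, c = (1/2 : ℚ)). [folklore] -/
theorem xb12_14 : xbCellAny 12 (49/50 : ℚ) 575215096857089 582405285567803 (1/2 : ℚ) = true := by
  decide +kernel

set_option maxHeartbeats 4000000 in
/-- kernel fact: cell 15 at `L = 12` (certified, c = (9/20 : ℚ)). [folklore] -/
theorem xb12_15 : xbCellAny 12 (49/50 : ℚ) 582405285567803 591505368154800 (9/20 : ℚ) = true := by
  decide +kernel

set_option maxHeartbeats 4000000 in
/-- kernel fact: cell 16 at `L = 12` (certified, c = (2/5 : ℚ)). [folklore] -/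
theorem xb12_16 : xbCellAny 12 (49/50 : ℚ) 591505368154800 603058207376574 (2/5 : ℚ) = true := by
  decide +kernel

set_option maxHeartbeats 4000000 in
/-- kernel fact: cell 17 at `L = 12` (certified, c = (2/5 : ℚ)). [folklore] -/
theorem xb12_17 : xbCellAny 12 (49/50 : ℚ) 603058207376574 617781308142604 (2/5 : ℚ) = true := by
  decide +kernel

set_option maxHeartbeats 4000000 in
/-- kernel fact: cell 18 at `L = 12` (certified, c = (7/20 : ℚ)). [folklore] -/
theorem xb12_18 : xbCellAny 12 (49/50 : ℚ) 617781308142604 636634497478011 (7/20 : ℚ) = true := by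
  decide +kernel

set_option maxHeartbeats 4000000 in
/-- kernel fact: cell 19 at `L = 12` (certified, c = (3/10 : ℚ)). [folklore] -/
theorem xb12_19 : xbCellAny 12 (49/50 : ℚ) 636634497478011 660920176245331 (3/10 : ℚ) = true := by
  decide +kernel

set_option maxHeartbeats 4000000 in
/-- kernel fact: cell 20 at `L = 12` (certified, c = (7/20 : ℚ)). [folklore] -/
theorem xb12_20 : xbCellAny 12 (49/50 : ℚ) 660920176245331 680617132410327 (7/20 : ℚ) = true := by
  decide +kernel

set_option maxHeartbeats 4000000 in
/-- kernel fact: cell 21 at `L = 12` (certified, c = (3/10 : ℚ)). [folklore] -/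
theorem xb12_21 : xbCellAny 12 (49/50 : ℚ) 680617132410327 705972096413679 (3/10 : ℚ) = true := by
  decide +kernel

end FinXB

end Summit.HubbardSuperconductivity.HubbardSuperconductivity.Theorems.AnisotropyChord.Transfer.Fibre3
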